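import Summits.Ventures.PercRepro.C026GluingN

/-!
# A concrete coloured gluing, decided by the kernel (p6, gen 9)

A toy instance for the demo: five vertices `a = 0, b = 1, c = 2, x = 3, y = 4`, four edges
`a–x, x–b` (colour `0`) and `a–y, y–c` (colour `1`).  The non-marks `x, y` are one-coloured, so the
graph is an `IsGluingN` over `Fin 2` — checked by `decide` through `decidableIsGluingN` — while the
colouring that swaps the colours of the two edges at `x` is not.
-/

namespace PercRepro

namespace MultiGraph

/-- The toy graph: `a–x, x–b, a–y, y–c` on `Fin 5`. -/
def toyStar : MultiGraph (Fin 5) (Fin 4) := ⟨![0, 3, 0, 4], ![3, 1, 4, 2]⟩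

/-- The colouring by branch: the `x`-branch is colour `0`, the `y`-branch colour `1`. -/
def toyCol : Fin 4 → Fin 2 := ![0, 0, 1, 1]

/-- The toy graph is a 2-coloured gluing at `0, 1, 2` (kernel-decided). -/
theorem toyStar_isGluingN : toyStar.IsGluingN 0 1 2 toyCol := by decide

/-- Colouring the two edges at `x` differently breaks the gluing property (kernel-decided). -/
theorem toyStar_not_isGluingN : ¬ toyStar.IsGluingN 0 1 2 ![0, 1, 1, 1] := by decide

end MultiGraph

end PercRepro
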